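import Summits.QuantumFields.BalabanUV.Beta.FP.TowerFWeightDualGaugeOfColumn

/-!
# `BalabanUV.Beta.FP.TowerFWeightColumnStraight` — row D1 ∕ (C1) OWNER «beta-an2», PART 101a, ROUTE T (β1), option (3a): **THE COLUMN LETTER (K1ᶜ) REDUCED BY NAME TO ONE
# «DRESSING-INVISIBILITY» LETTER (DIᶜ), WITH ITS SCALAR** — two exact identities and one assembly (journal [AN2-G85-W-14] `K1C-SCOPING.md` steps (1), (7), (8)):
# (1) the σ-conjugated record chart's `ℋ`-column is `(sn n)⁻¹ ·` the record chart's (`colH_chartσ_eq`); (7) **the middle-scale straight contour sum of the STRAIGHT one-step column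
# is the canonical step column EXACTLY**: `contourSum (Lc^(n+1)) (colH (KInv (N := Lc^(n+2))) (Lc^(n+2)) a 0) c t = wStep Lc (n+1) c a (−t)` (`contourSum_colH_KInv_eq_wStep` — lit
# `stepCol_eq`'s leg enumeration `LegIdx = box ×ˢ range`, `legOff c (b,s) = toSite b + s•e_c` IS `contourSum`'s, and `Lc^(5j) · ((Lc^j)^5)⁻¹ = 1`; this is also Engine C's TEL2 (A1)
# realisation «`wStep 3 1 = contourSum₃(wH₉)`» as a theorem at every storey); (8) hence PART 100's displayed `hK1c` (K1ᶜ)_n FOLLOWS from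
# **(DIᶜ)_n : `⟨ψ, contourSum (Lc^(n+1)) (colH (AN (Roots.ctr Lc) (n+1)) (Lc^(n+2)) a 0)⟩ = ⟨ψ, contourSum (Lc^(n+1)) (colH (KInv) (Lc^(n+2)) a 0)⟩` for bounded co-closed `ψ`**
# (the composite chart's two dressings — `corrPsi`'s `dz (ext …)` and the block-mean gauge `grad (bmGaugeAt …)` — are fine gradients, their contour sums coarse gradients (lit
# `contourSum_dz`), invisible to co-closed covectors; NOT proved here: K1C-SCOPING steps (2)–(6)) **at the scalar `α n = (sn n · (Lc⁴)^(n+1))⁻¹`** (`columnLetter_of_dressingInvisible`),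
# and so does the road's `hgaugeD n` at both row tokens (`hgaugeD_rooted∕sym_of_dressingInvisible`, PART 100).  At (4,3), n = 0, sn 0 = 3⁵: α 0 = 3⁻⁹ (PREDICTION-AN2-85d's reading).
# (β-function cell `pub-balaban`, BINDER-OWNERS row D1)

WHAT ([folklore]; 0 `def`): §1 `colH_chartσ_eq`, `contourSum_colH_chartσ_eq`; §2 `legOff_sub_smul_neg`, `wStep_prefactor_mul_inv`, **`contourSum_colH_KInv_eq_wStep`**; §3
**`columnLetter_of_dressingInvisible`**, `alpha_ne_zero_of_eq`, **`hgaugeD_rooted_of_dressingInvisible`**, **`hgaugeD_sym_of_dressingInvisible`**.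
WHAT THIS IS NOT: not (DIᶜ) (displayed); not (K1ᶜ) unconditionally; nothing of the END instantiated; nothing of Bałaban's asserted, valued or discharged; 0 estimates; 0∕4 row-D1
binders; NOT (C1), NOT D1, NEVER «G-an2-4 closed», NOT BetaPertH, NOT continuum, NOT Clay.

HONEST DEPENDENCY (page 1, mandatory): continuum YM on T⁴ ⇐ BetaPertH ∧ nine spine estimates (0/9 proved); BetaPertH ⇐ (D1) ∧ (D4) ∧ CAP+tail;
G-an2-4 gates asym, D1 and NE2/3/4.  HONEST FRAMING (cell contract, verbatim): «discharging `BetaPertH` makes Bałaban's UV stability UNCONDITIONAL —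
a real constructive-QFT result; it is NOT the continuum limit and NOT the Clay problem.»  ABSOLUTE RULE (cell charter, verbatim): «No internally-minted
statement may enter as a cited fact. Every hypothesis is either kernel-proved in this package or a verbatim quotation of a PUBLISHED theorem with page
reference. The manuscript(s) under audit are NOT citable for their own disputed steps — they are the thing under adjudication; programme-internal
(2001/route/tribunal) claims are never citable.»  Row D1 ∕ (C1) OWNER «beta-an2», b2b-balaban-beta-an2 gen 85, 2026-08-30.  No existing file touched.
-/

noncomputable section

open Finset
open scoped BigOperators
open Literature.MathematicalPhysics.QuantumFieldTheory
open Literature.MathematicalPhysics.QuantumFieldTheory.Balaban1983to89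
open Literature.MathematicalPhysics.QuantumFieldTheory.Balaban1983to89.Beta
open AffineAveraging (Form0 Form1 Site box toSite unitVec unitVec_apply dz codiff₁ contourSum)
open AveragingContoursRooted (ctrOff ctrOff_mem_box)
open AveragingHessianKernels (Bond ell)
open AveragingHessianKernelsRooted (linKerAt)
open OneStepResolventKernel (Fib KInv)
open OneStepKernelFamily (colH LegIdx)
open KKTFluctuationEnergy (lip1)
open DressedMomentNormalisation (EKer)
open HessKerRate (scaleK)
open HessianTelescopingKKT (wStep stepCol stepCol_eq legOff KInv_inl_inr_zero)
open Summit.QuantumFields.BalabanUV.Beta.SymAveragingHessianCounts (symLinKerAt)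
open Summit.QuantumFields.BalabanUV.Beta.CompositeOneShotJetData (Roots Roots.ctr AN)
open Summit.QuantumFields.BalabanUV.Beta.CoclosedCovectorLinearRowsNear (lip1_const_mul_right)
open Summit.QuantumFields.BalabanUV.Beta.FP.TorusCompositeObjectsG (StepRows)
open Summit.QuantumFields.BalabanUV.Beta.FP.TowerFWeightRecDefs
open Summit.QuantumFields.BalabanUV.Beta.FP.TowerFWeightDualGaugeOfColumn (hgaugeD_rooted_of_columnLetter hgaugeD_sym_of_columnLetter)

namespace Summit.QuantumFields.BalabanUV.Beta.FP.TowerFWeightColumnStraight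

/-! ## §1 The σ-letter on the column (K1C-SCOPING step (1)) -/

section Sigma

variable (Lc : ℕ) [NeZero Lc]

/-- [folklore] **the σ-conjugated chart's `ℋ`-column is `s⁻¹ ·` the record chart's**: `scaleK (1 ⊕ s⁻¹) (1 ⊕ s⁻¹) K` read at `(inl κ′, inr μ)` multiplies by `1 · s⁻¹`. -/
theorem colH_chartσ_eq (s : ℝ) (n L : ℕ) (μ : Fin (3 + 1)) (y : Site (3 + 1)) (κ' : Fin (3 + 1)) (u : Site (3 + 1)) :
    colH (chartσ Lc s n) L μ y κ' u = s⁻¹ * colH (AN (Roots.ctr Lc) (n + 1)) L μ y κ' u := by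
  simp only [colH, chartσ_eq, scaleK, Sum.elim_inl, Sum.elim_inr]
  ring

/-- [folklore] … hence so is its straight contour sum at any scale `M` (a finite sum). -/
theorem contourSum_colH_chartσ_eq (s : ℝ) (n M L : ℕ) (μ : Fin (3 + 1)) (y : Site (3 + 1)) (c : Fin (3 + 1)) (t : Site (3 + 1)) :
    contourSum M (fun κ' u => colH (chartσ Lc s n) L μ y κ' u) c t
      = s⁻¹ * contourSum M (fun κ' u => colH (AN (Roots.ctr Lc) (n + 1)) L μ y κ' u) c t := by
  simp only [contourSum, colH_chartσ_eq, Finset.mul_sum]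

end Sigma

/-! ## §2 The straight column's middle contour sum is the canonical step column (K1C-SCOPING step (7)) -/

section Straight

variable (Lc : ℕ) [NeZero Lc]

/-- [folklore] the leg offset read at `−t`: `legOff c (b, s) − M•(−t) = M•t + toSite b + s•e_c` (lit `legOff`, lit `toSite`, `unitVec = Pi.single`). -/
theorem legOff_sub_smul_neg (M : ℕ) (c : Fin (3 + 1)) (b : Fin (3 + 1) → ℕ) (s : ℕ) (t : Site (3 + 1)) :
    legOff c (b, s) - ((M : ℕ) : ℤ) • (-t) = (M : ℤ) • t + toSite b + (s : ℤ) • unitVec c := by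
  funext j
  simp only [legOff, toSite, Pi.sub_apply, Pi.add_apply, Pi.smul_apply, Pi.neg_apply, smul_eq_mul, unitVec_apply]
  split_ifs <;> ring

/-- [folklore] the normalisation cancels the leg mean's weight: `Lc^(5j) · ((Lc^j)^(3+2))⁻¹ = 1`. -/
theorem wStep_prefactor_mul_inv (j : ℕ) : (Lc : ℝ) ^ (5 * j) * ((((Lc ^ j : ℕ) : ℝ)) ^ (3 + 2))⁻¹ = 1 := by
  have hL : (Lc : ℝ) ≠ 0 := by exact_mod_cast (NeZero.ne Lc)
  have h : (((Lc ^ j : ℕ) : ℝ)) ^ (3 + 2) = (Lc : ℝ) ^ (5 * j) := by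
    push_cast
    rw [← pow_mul, mul_comm]
  rw [h, mul_inv_cancel₀ (pow_ne_zero _ hL)]

/-- [folklore] **THE STRAIGHT COLUMN's MIDDLE CONTOUR SUM IS THE CANONICAL STEP COLUMN, EXACTLY** (scalar `1`): for `M = Lc^(n+1)`, `L = Lc^(n+2)`,
`contourSum M (colH (KInv (N := L)) L a 0) c t = wStep Lc (n+1) c a (−t)` — lit `stepCol_eq` enumerates the legs over `LegIdx 3 M = box 4 M ×ˢ range M` at `legOff c (b,s) − M•p`
with weight `(M^5)⁻¹`, which at `p = −t` is `contourSum`'s own enumeration `M•t + toSite b + s•e_c` (`legOff_sub_smul_neg`), the kernel entry is `wH` (lit `KInv_inl_inr_zero`), and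
`wStep = Lc^(5(n+1)) • stepCol` cancels the weight (`wStep_prefactor_mul_inv`).  Engine C's TEL2 (A1) realisation `wStep 3 1 = contourSum₃(wH₉)` is the case `Lc = 3, n = 0`. -/
theorem contourSum_colH_KInv_eq_wStep (n : ℕ) (a c : Fin (3 + 1)) (t : Site (3 + 1)) :
    contourSum (Lc ^ (n + 1)) (fun κ' u => colH (KInv (N := Lc ^ (n + 1 + 1))) (Lc ^ (n + 1 + 1)) a 0 κ' u) c t
      = wStep Lc (n + 1) c a (-t) := by
  have hw : wStep Lc (n + 1) c a (-t) = (Lc : ℝ) ^ (5 * (n + 1)) * stepCol (d := 3) Lc (n + 1) c a (-t) := rfl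
  rw [hw, stepCol_eq, Finset.mul_sum]
  simp only [contourSum, colH, smul_zero, KInv_inl_inr_zero, LegIdx, AffineAveraging.box, Finset.sum_product]
  refine Finset.sum_congr rfl fun b _ => Finset.sum_congr rfl fun s _ => ?_
  rw [← mul_assoc, wStep_prefactor_mul_inv, one_mul, legOff_sub_smul_neg]

end Straight

/-! ## §3 (K1ᶜ) from the dressing-invisibility letter (DIᶜ), with the scalar `α n = (sn n · (Lc⁴)^(n+1))⁻¹` (K1C-SCOPING step (8)) -/

section Assemble

variable (Lc : ℕ) [NeZero Lc] (Q : StepRows 3 Lc) (sn α : ℕ → ℝ)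

/-- [folklore] **`columnLetter_of_dressingInvisible` — (K1ᶜ)_n ⟸ (DIᶜ)_n AT `α n = (sn n · (Lc⁴)^(n+1))⁻¹`.**  If the record chart's column and the STRAIGHT column have the same
middle contour-sum pairing with every bounded co-closed covector ((DIᶜ), `hinv` — displayed), then PART 100's column letter holds with that scalar: §1 peels `(sn n)⁻¹`, §2 turns the
straight contour sum into `wStep Lc (n+1) · a (−·)`, and `(sn n)⁻¹ = α n · (((Lc⁴)⁻¹)^(n+1))⁻¹`. -/
theorem columnLetter_of_dressingInvisible (n : ℕ) (hαv : α n = (sn n * ((Lc : ℝ) ^ (3 + 1)) ^ (n + 1))⁻¹)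
    (hinv : ∀ (a : Fin (3 + 1)) (ψ : Form1 (3 + 1) ℝ) (M : ℝ), (∀ c x, |ψ c x| ≤ M) → codiff₁ ψ = 0 →
      lip1 ψ (contourSum (Lc ^ (n + 1)) (fun κ' u => colH (AN (Roots.ctr Lc) (n + 1)) (Lc ^ (n + 1 + 1)) a 0 κ' u))
        = lip1 ψ (contourSum (Lc ^ (n + 1)) (fun κ' u => colH (KInv (N := Lc ^ (n + 1 + 1))) (Lc ^ (n + 1 + 1)) a 0 κ' u)))
    (a : Fin (3 + 1)) (ψ : Form1 (3 + 1) ℝ) (M : ℝ) (hψ : ∀ c x, |ψ c x| ≤ M) (hco : codiff₁ ψ = 0) :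
    lip1 ψ (contourSum (Lc ^ (n + 1)) (fun κ' u => colH (chartσ Lc (sn n) n) (Lc ^ (n + 1 + 1)) a 0 κ' u))
      = (α n * (((((Lc : ℝ) ^ (3 + 1))⁻¹) ^ (n + 1))⁻¹)) * lip1 ψ (fun c x => wStep Lc (n + 1) c a (-x)) := by
  have hL : (Lc : ℝ) ≠ 0 := by exact_mod_cast (NeZero.ne Lc)
  have h1 : contourSum (Lc ^ (n + 1)) (fun κ' u => colH (chartσ Lc (sn n) n) (Lc ^ (n + 1 + 1)) a 0 κ' u)
      = fun c t => (sn n)⁻¹ * contourSum (Lc ^ (n + 1)) (fun κ' u => colH (AN (Roots.ctr Lc) (n + 1)) (Lc ^ (n + 1 + 1)) a 0 κ' u) c t := by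
    funext c t
    exact contourSum_colH_chartσ_eq Lc (sn n) n (Lc ^ (n + 1)) (Lc ^ (n + 1 + 1)) a 0 c t
  have h7 : contourSum (Lc ^ (n + 1)) (fun κ' u => colH (KInv (N := Lc ^ (n + 1 + 1))) (Lc ^ (n + 1 + 1)) a 0 κ' u)
      = fun c x => wStep Lc (n + 1) c a (-x) := by
    funext c t
    exact contourSum_colH_KInv_eq_wStep Lc n a c t
  rw [h1, lip1_const_mul_right, hinv a ψ M hψ hco, h7, hαv]
  congr 1
  rw [inv_pow, inv_inv, mul_inv, mul_assoc, inv_mul_cancel₀ (pow_ne_zero _ (pow_ne_zero _ hL)), mul_one]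

/-- [folklore] the scalar is non-zero when `sn n ≠ 0`. -/
theorem alpha_ne_zero_of_eq (n : ℕ) (hsn : sn n ≠ 0) (hαv : α n = (sn n * ((Lc : ℝ) ^ (3 + 1)) ^ (n + 1))⁻¹) : α n ≠ 0 := by
  have hL : (Lc : ℝ) ≠ 0 := by exact_mod_cast (NeZero.ne Lc)
  rw [hαv]
  exact inv_ne_zero (mul_ne_zero hsn (pow_ne_zero _ (pow_ne_zero _ hL)))

/-- [folklore] **`hgaugeD_rooted_of_dressingInvisible` — THE ROAD's `hgaugeD n` AT THE ROOTED ROWS FROM (DIᶜ)_n ALONE** (PART 100 `hgaugeD_rooted_of_columnLetter` ∘ §3), at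
`α n = (sn n · (Lc⁴)^(n+1))⁻¹`, `sn n ≠ 0`. -/
theorem hgaugeD_rooted_of_dressingInvisible (n : ℕ) (hsn : sn n ≠ 0) (hαv : α n = (sn n * ((Lc : ℝ) ^ (3 + 1)) ^ (n + 1))⁻¹)
    (hinv : ∀ (a : Fin (3 + 1)) (ψ : Form1 (3 + 1) ℝ) (M : ℝ), (∀ c x, |ψ c x| ≤ M) → codiff₁ ψ = 0 →
      lip1 ψ (contourSum (Lc ^ (n + 1)) (fun κ' u => colH (AN (Roots.ctr Lc) (n + 1)) (Lc ^ (n + 1 + 1)) a 0 κ' u))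
        = lip1 ψ (contourSum (Lc ^ (n + 1)) (fun κ' u => colH (KInv (N := Lc ^ (n + 1 + 1))) (Lc ^ (n + 1 + 1)) a 0 κ' u)))
    (a : Fin (3 + 1)) (ψ : Form1 (3 + 1) ℝ) (M : ℝ) (hψ : ∀ c x, |ψ c x| ≤ M) (hco : codiff₁ ψ = 0) :
    lip1 ψ (fun c x => (α n)⁻¹ * wF Lc Q (linKerAt (toSite (ctrOff (3 + 1) Lc)) Lc) sn n c a (-x) - wStep Lc (n + 1) c a (-x)) = 0 :=
  hgaugeD_rooted_of_columnLetter Lc Q sn α n (alpha_ne_zero_of_eq Lc sn α n hsn hαv)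
    (fun a' ψ' M' hψ' hco' => columnLetter_of_dressingInvisible Lc sn α n hαv hinv a' ψ' M' hψ' hco') a ψ M hψ hco

/-- [folklore] **`hgaugeD_sym_of_dressingInvisible`** — the same at the (0.4)-symmetrised rows (PART 100 `hgaugeD_sym_of_columnLetter` ∘ §3). -/
theorem hgaugeD_sym_of_dressingInvisible (R : Roots Lc) (n : ℕ) (hsn : sn n ≠ 0) (hαv : α n = (sn n * ((Lc : ℝ) ^ (3 + 1)) ^ (n + 1))⁻¹)
    (hinv : ∀ (a : Fin (3 + 1)) (ψ : Form1 (3 + 1) ℝ) (M : ℝ), (∀ c x, |ψ c x| ≤ M) → codiff₁ ψ = 0 →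
      lip1 ψ (contourSum (Lc ^ (n + 1)) (fun κ' u => colH (AN (Roots.ctr Lc) (n + 1)) (Lc ^ (n + 1 + 1)) a 0 κ' u))
        = lip1 ψ (contourSum (Lc ^ (n + 1)) (fun κ' u => colH (KInv (N := Lc ^ (n + 1 + 1))) (Lc ^ (n + 1 + 1)) a 0 κ' u)))
    (a : Fin (3 + 1)) (ψ : Form1 (3 + 1) ℝ) (M : ℝ) (hψ : ∀ c x, |ψ c x| ≤ M) (hco : codiff₁ ψ = 0) :
    lip1 ψ (fun c x => (α n)⁻¹ * wF Lc Q (symLinKerAt (toSite R.r) Lc) sn n c a (-x) - wStep Lc (n + 1) c a (-x)) = 0 :=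
  hgaugeD_sym_of_columnLetter Lc Q sn α R n (alpha_ne_zero_of_eq Lc sn α n hsn hαv)
    (fun a' ψ' M' hψ' hco' => columnLetter_of_dressingInvisible Lc sn α n hαv hinv a' ψ' M' hψ' hco') a ψ M hψ hco

end Assemble

end Summit.QuantumFields.BalabanUV.Beta.FP.TowerFWeightColumnStraight

end
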